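import Summits.MatrixMultiplication.MatrixMultiplication.Theorems.SoloInformedTwistedTPPNormalForm
import Summits.MatrixMultiplication.MatrixMultiplication.Theorems.SoloInformedTwistedTPPFiveTerm

/-!
# The flat case of few-multiplier TPP stability — no fixed-point-freeness needed

Setting of `SoloInformedTwistedTPPFiveTerm` (a `TwistedRealization A S I J K`: orbit representatives
`a, b, d` and a pattern `φ, ψ : I → J → K → A` of a CU13 Def.-12 realization of `⟨|I|,|J|,|K|⟩` in the
translation scheme of `S` with abelian multiplier group `A`, module docstring there).

Theorem C2 (`TwistedRealization.cube_le`) needs the multiplier group to act fixed-point-freely, and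
uses that hypothesis in exactly one place (the five-term lemma). This file records the part of the
argument that survives for an ARBITRARY action `sm : A → S →+ S` (fixed points allowed):

* `card_cube_le_of_trivial_holonomy`: if the three holonomies of the pattern (the `φ`-slice `j₀`, the
  `ψ`-slice `i₀`, the `(ψ-φ)`-slice `k₀`, based at a triple `(i₀,j₀,k₀)`) vanish on the WHOLE index box,
  then `|I|·|J|·|K| ≤ |S|` — the realization is gauge-equivalent to an untwisted TPP normal form, whose
  sum map is injective by the realization property;
* `card_cube_le_of_constant_pattern`: in particular a realization with a constant pattern
  (`φ ≡ φ₀`, `ψ ≡ ψ₀`) has `|I|·|J|·|K| ≤ |S|`.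

So for translation schemes `𝒮(S,M₀)` with `|M₀| = m` (any finite abelian `M₀ ≤ Aut S`), a FLAT
realization of `⟨n,n,n⟩` forces `|S| ≥ n³`, hence rank `≥ n³/m`: all the difficulty of removing the
fixed-point-free hypothesis from Theorem C2 (Conjecture C3 of this work) lies in non-flat patterns.
References: CohnUmans2013 (arXiv:1207.6528) Def. 12, Conj. 21; this work, Thm C2 and §8 (C3).
-/

namespace Summit.MatrixMultiplication.MatrixMultiplication.Theorems.TwistedTPP

namespace TwistedRealization

variable {A S I J K : Type*} [AddCommGroup A] [AddCommGroup S]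

/-- **Flat realizations are TPP-sized, for any action.** If the `φ`-holonomy of slice `j₀`, the
`ψ`-holonomy of slice `i₀` and the `(ψ-φ)`-holonomy of slice `k₀` (based at `(i₀,j₀,k₀)`) vanish
everywhere, then `|I|·|J|·|K| ≤ |S|`; no fixed-point-freeness is assumed. [this work, §8 flat lemma] -/
theorem card_cube_le_of_trivial_holonomy [Fintype I] [Fintype J] [Fintype K] [Fintype S]
    [DecidableEq I] [DecidableEq J] [DecidableEq K]
    (R : TwistedRealization A S I J K) (i₀ : I) (j₀ : J) (k₀ : K)
    (R1 : ∀ i k, R.φ i j₀ k - R.φ i j₀ k₀ = R.φ i₀ j₀ k - R.φ i₀ j₀ k₀)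
    (R2 : ∀ j k, R.ψ i₀ j k - R.ψ i₀ j k₀ = R.ψ i₀ j₀ k - R.ψ i₀ j₀ k₀)
    (R3 : ∀ i j, (R.ψ i j k₀ - R.φ i j k₀) - (R.ψ i j₀ k₀ - R.φ i j₀ k₀)
        = (R.ψ i₀ j k₀ - R.φ i₀ j k₀) - (R.ψ i₀ j₀ k₀ - R.φ i₀ j₀ k₀)) :
    Fintype.card I * Fintype.card J * Fintype.card K ≤ Fintype.card S := by
  have h := card_box_le_of_flat_slices R.sm R.sm_add R.sm_zero R.a R.b R.d R.φ R.ψ R.eqn R.real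
    Finset.univ Finset.univ Finset.univ (Finset.mem_univ i₀) (Finset.mem_univ j₀) (k₀ := k₀)
    (fun i _ k _ => R1 i k) (fun j _ k _ => R2 j k) (fun i _ j _ => R3 i j)
  simpa [Finset.card_univ] using h

/-- **Constant patterns.** A realization whose pattern is constant (`φ ≡ φ₀`, `ψ ≡ ψ₀`) has
`|I|·|J|·|K| ≤ |S|`, for any action of the multiplier group. [this work, §8 flat lemma] -/
theorem card_cube_le_of_constant_pattern [Fintype I] [Fintype J] [Fintype K] [Fintype S]
    [DecidableEq I] [DecidableEq J] [DecidableEq K]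
    (R : TwistedRealization A S I J K) (φ₀ ψ₀ : A)
    (hφ : ∀ i j k, R.φ i j k = φ₀) (hψ : ∀ i j k, R.ψ i j k = ψ₀) :
    Fintype.card I * Fintype.card J * Fintype.card K ≤ Fintype.card S := by
  rcases isEmpty_or_nonempty I with hI | ⟨⟨i₀⟩⟩
  · simp
  rcases isEmpty_or_nonempty J with hJ | ⟨⟨j₀⟩⟩
  · simp
  rcases isEmpty_or_nonempty K with hK | ⟨⟨k₀⟩⟩
  · simp
  exact R.card_cube_le_of_trivial_holonomy i₀ j₀ k₀ (fun i k => by simp [hφ])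
    (fun j k => by simp [hψ]) (fun i j => by simp [hφ, hψ])

/-- **Cube form.** For `⟨n,n,n⟩`: a constant-pattern realization has `n³ ≤ |S|`, whatever the
action (compare `cube_le`: `n³ ≤ 115200·|A|¹⁰·|S|` under fixed-point-freeness). [this work, §8] -/
theorem cube_le_of_constant_pattern [Fintype S] {n : ℕ}
    (R : TwistedRealization A S (Fin n) (Fin n) (Fin n)) (φ₀ ψ₀ : A)
    (hφ : ∀ i j k, R.φ i j k = φ₀) (hψ : ∀ i j k, R.ψ i j k = ψ₀) :
    n ^ 3 ≤ Fintype.card S := by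
  have h := R.card_cube_le_of_constant_pattern φ₀ ψ₀ hφ hψ
  simpa [Fintype.card_fin, pow_succ, mul_assoc] using h

end TwistedRealization

end Summit.MatrixMultiplication.MatrixMultiplication.Theorems.TwistedTPP
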